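import Literature.AnabelianGeometry.AbsoluteAnabelian.AbsTopICuspidalDecompositionSubProofs
import Literature.AnabelianGeometry.SemiGraphs.PSCGraphicity
import Literature.AnabelianGeometry.SemiGraphs.PSCSeparatingCoveringsProofs
import Literature.AnabelianGeometry.SemiGraphs.PSCRamification
import HarnessLib

/-!
# [AbsTopI] Lemma 4.5 SUB-DAG — the L3↔L4 bridge: cusp-inertia data OF a PSC datum

abc-iut cell, layer L4 (seat abc-iut-w5-d062, holder of «SUBDAG AbsTopI:Lem4.5 (iii)(iv)(v)», table
`plan/L4/SUBDAG-AbsTopI-Lem45.md`).  The §B/§C sub-nodes of `AbsTopICuspidalDecompositionSub.lean` are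
typed over the abstract INPUT `FundamentalExtension.CuspInertiaData H_*` (cusps, cusp inertia
subgroups of `H_*`, cusp numbers).  Print obtains these from the semi-graph of anabelioids of
pro-`l` PSC-type of the (smooth) covering determined by `H` ([CombGC] Def. 1.1 (ii): the cuspidal
edge-like subgroups `Π_c ⊆ Π_G = H_*`), which layer L3 types as `SemiGraphs.PSCDatum`.  This file
CONSTRUCTS `CuspInertiaData.ofPSC G` from any `G : PSCDatum H_*` (cusps := `G.graph.C`, inertia :=
`G.cuspGp`, `r := G.cuspCount`) and DISCHARGES, relative to L3's named [CombGC] Prop. 1.2 predicates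
ON THAT DATUM, the sub-nodes C1 (`DistinctCuspsNotCommensurable` ⟸ `EdgeLikeOpenInterDeterminesEdge`
= Prop. 1.2 (i), edge-like case), C2 (`InertiaCommensurablyTerminal` ⟸
`VerticialEdgeLikeCommensurablyTerminal` = Prop. 1.2 (ii)), the closedness half of B1, and B4
(`InertiaIffMaximalTotRam` ⟸ L3's `CuspidalEdgeLikeCharacterization` = [IUTchI] Rmk. 1.2.3 (iv), modulo
the hypothesis `henc` equating the two encodings of "`≅ ℤ_l`" on closed subgroups of `H_*`).
Locators: [AbsTopI] Lemma 4.5 (iv)(v) p. 54–55 (kurims `paper:url-11ac98ba15fc`); [CombGC] Def. 1.1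
(ii) p. 6, Prop. 1.2 (i)(ii) p. 8 (kurims `paper:url-6994f81053dc`).  HONEST FRAMING: refereed pre-IUT
anabelian geometry; the [CombGC] predicates stay named inputs (FACT-policy, consumed by name);
nothing here bears on [IUTchIII] Cor. 3.12.
-/

noncomputable section

open scoped Pointwise

namespace Literature.AnabelianGeometry.AbsoluteAnabelian.FundamentalExtension

open Literature.AnabelianGeometry.SemiGraphs

universe u

variable {Hstar : Type u} [Group Hstar] [TopologicalSpace Hstar]

omit [TopologicalSpace Hstar] in
/-- Conjugating a subgroup by `MulAut.conj h` (the parents' `MulAut.conj g • D`) is conjugating by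
`ConjAct.toConjAct h` (layer L3's `γ • Π_c`). [folklore] -/
private theorem conj_smul_eq_toConjAct_smul (h : Hstar) (S : Subgroup Hstar) :
    MulAut.conj h • S = ConjAct.toConjAct h • S := by
  ext x
  simp only [Subgroup.mem_smul_pointwise_iff_exists, ConjAct.smul_def, ConjAct.ofConjAct_toConjAct,
    MulAut.smul_def, MulAut.conj_apply]

/-- **The cusp-inertia data of a PSC datum on `H_*`** ([CombGC] Def. 1.1 (ii) p. 6: "an edge of `𝔾`
determines, up to conjugation, a closed subgroup `Π_e`"; cusp numbers `r(G_H)` = layer L3's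
double-coset count `PSCDatum.cuspCount`).  The cusp index type is lifted to the universe of `H_*`.
[cite: MochizukiCombGC2007, Def 1.1(ii) p.6] [cite: MochizukiAbsTopI2012, Lemma 4.5 (iv) p.54] -/
def CuspInertiaData.ofPSC (G : PSCDatum Hstar) : CuspInertiaData Hstar where
  Cusp := ULift.{u} G.graph.C
  finite := inferInstance
  inertia x := G.cuspGp x.down
  r := ⟨G.cuspCount⟩

variable (G : PSCDatum Hstar)

/-- The cusp inertia subgroup of `ofPSC G` at `c` is `Π_c`. [cite: MochizukiCombGC2007, Def 1.1(ii) p.6] -/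
@[simp] theorem CuspInertiaData.ofPSC_inertia (x : ULift.{u} G.graph.C) :
    (CuspInertiaData.ofPSC G).inertia x = G.cuspGp x.down := rfl

/-- The cusp numbers of `ofPSC G` are layer L3's `cuspCount` ("`r(G)`", [CombGC] Def. 1.1 (i)(ii)).
[cite: MochizukiCombGC2007, Def 1.1(ii) p.6] -/
@[simp] theorem CuspInertiaData.ofPSC_r (V : Subgroup Hstar) :
    (CuspInertiaData.ofPSC G).r.r V = G.cuspCount V := rfl

/-- The cusp inertia subgroups of `ofPSC G` are exactly layer L3's CUSPIDAL (edge-like) subgroups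
`γ • Π_c`. [cite: MochizukiCombGC2007, Def 1.1(ii) p.6] -/
theorem CuspInertiaData.mem_inertiaSet_ofPSC_iff (I : Subgroup Hstar) :
    I ∈ (CuspInertiaData.ofPSC G).inertiaSet ↔ G.IsCuspidal I := by
  constructor
  · rintro ⟨x, h, rfl⟩
    exact ⟨x.down, ConjAct.toConjAct h, by rw [CuspInertiaData.ofPSC_inertia, conj_smul_eq_toConjAct_smul]⟩
  · rintro ⟨c, γ, rfl⟩
    refine ⟨ULift.up c, ConjAct.ofConjAct γ, ?_⟩
    rw [CuspInertiaData.ofPSC_inertia, conj_smul_eq_toConjAct_smul, ConjAct.toConjAct_ofConjAct]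

/-- **SUB-NODE C2 of the Lem 4.5 SUB-DAG, DISCHARGED relative to [CombGC] Prop. 1.2 (ii) on the
datum**: if the verticial/edge-like subgroups of `G` are commensurably terminal (layer L3's
`VerticialEdgeLikeCommensurablyTerminal`), the cusp inertia subgroups of `ofPSC G` are commensurably
terminal. [cite: MochizukiCombGC2007, Prop 1.2(ii) p.8] [cite: MochizukiAbsTopI2012, Lemma 4.5 (v) p.55] -/
theorem CuspInertiaData.inertiaCommensurablyTerminal_ofPSC
    (h : G.VerticialEdgeLikeCommensurablyTerminal) :
    (CuspInertiaData.ofPSC G).InertiaCommensurablyTerminal := by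
  intro I hI
  rw [CuspInertiaData.mem_inertiaSet_ofPSC_iff] at hI
  exact ⟨h I (Or.inr (Or.inr hI))⟩

/-- **SUB-NODE C1 of the Lem 4.5 SUB-DAG, DISCHARGED relative to [CombGC] Prop. 1.2 (i) on the
datum**: if open intersections of edge-like subgroups determine the edge (layer L3's
`EdgeLikeOpenInterDeterminesEdge`), cusp inertia subgroups of distinct cusps of `ofPSC G` are not
commensurable. [cite: MochizukiCombGC2007, Prop 1.2(i) p.8] [cite: MochizukiAbsTopI2012, Lemma 4.5 (v) p.55] -/
theorem CuspInertiaData.distinctCuspsNotCommensurable_ofPSC (h : G.EdgeLikeOpenInterDeterminesEdge) :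
    (CuspInertiaData.ofPSC G).DistinctCuspsNotCommensurable := by
  intro x y g hopen
  have key := h (Sum.inr y.down) (Sum.inr x.down) 1 (ConjAct.toConjAct g)
  have e1 : (1 : ConjAct Hstar) • G.edgeGp (Sum.inr y.down) = G.cuspGp y.down := one_smul _ _
  have e2 : G.edgeGp (Sum.inr x.down) = G.cuspGp x.down := rfl
  rw [e1, e2] at key
  have hxy : (Sum.inr y.down : G.graph.N ⊕ G.graph.C) = Sum.inr x.down := by
    apply key
    rw [CuspInertiaData.ofPSC_inertia, CuspInertiaData.ofPSC_inertia, conj_smul_eq_toConjAct_smul,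
      inf_comm] at hopen
    exact hopen
  have : y.down = x.down := Sum.inr_injective hxy
  exact ULift.ext _ _ this.symm

variable [IsTopologicalGroup Hstar]

/-- The closedness half of SUB-NODE B1 for `ofPSC G`: cusp inertia subgroups are closed (layer L3's
`PSCDatum.isClosed_cuspGp` + `isClosed_conj_smul`). [cite: MochizukiCombGC2007, Def 1.1(ii) p.6] -/
theorem CuspInertiaData.isClosed_of_mem_inertiaSet_ofPSC {I : Subgroup Hstar}
    (hI : I ∈ (CuspInertiaData.ofPSC G).inertiaSet) : IsClosed (I : Set Hstar) := by
  rw [CuspInertiaData.mem_inertiaSet_ofPSC_iff] at hI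
  obtain ⟨c, γ, rfl⟩ := hI
  exact PSCDatum.isClosed_conj_smul (G.isClosed_cuspGp c) γ

omit [IsTopologicalGroup Hstar] in
/-- SUB-NODE C3 for `ofPSC G`, relative to Prop. 1.2 (i): cusps ↔ conjugacy classes of cusp inertia
subgroups is a bijection (composition with the PROVED `cuspsBijInertiaClasses_of_distinct`).
[cite: MochizukiAbsTopI2012, Lemma 4.5 (v) p.55] -/
theorem CuspInertiaData.cuspsBijInertiaClasses_ofPSC (h : G.EdgeLikeOpenInterDeterminesEdge) :
    (CuspInertiaData.ofPSC G).CuspsBijInertiaClasses :=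
  cuspsBijInertiaClasses_of_distinct _ (CuspInertiaData.distinctCuspsNotCommensurable_ofPSC G h)


/-! ### SUB-NODE B4 at `ofPSC G`, REDUCED to layer L3's [IUTchI] Rmk 1.2.3 (iv) predicate -/

/-- For a characteristic open `U`, "totally ramified at some cusp" for `J := U ⊆ I·U` in the sense of
the Lem 4.5 SUB-DAG (`TotallyRamifiedAtSomeCusp`) is layer L3's `IsCuspidallyTotallyRamified (I ⊔ U) U`
([CombGC] Def. 1.4 (v)), provided the datum has a cusp (Lem 4.5 (iv): "`X` is not proper").
[cite: MochizukiCombGC2007, Def 1.4(v) p.11] [cite: MochizukiAbsTopI2012, Lemma 4.5 (iv) p.54] -/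
theorem CuspInertiaData.totallyRamifiedAtSomeCusp_ofPSC_iff
    (hC : Nonempty G.graph.C) (I U : Subgroup Hstar) (hU : U.Characteristic)
    (hUo : IsOpen (U : Set Hstar)) :
    (U ≠ I ⊔ U → (CuspInertiaData.ofPSC G).TotallyRamifiedAtSomeCusp (I ⊔ U) U) ↔
      G.IsCuspidallyTotallyRamified (I ⊔ U) U := by
  have hgal : PSCDatum.IsGaloisCovering (I ⊔ U) U := by
    refine ⟨le_sup_right, hUo, Subgroup.isOpen_mono le_sup_right hUo, ?_⟩
    haveI : U.Normal := inferInstance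
    exact Subgroup.Normal.subgroupOf inferInstance _
  constructor
  · intro h
    refine ⟨hgal, ?_⟩
    by_cases hIU : U = I ⊔ U
    · obtain ⟨c⟩ := hC
      refine ⟨c, 1, ?_⟩
      rw [← hIU]
      exact sup_eq_right.mpr inf_le_left
    · obtain ⟨I', hI', hram⟩ := h hIU
      rw [CuspInertiaData.mem_inertiaSet_ofPSC_iff] at hI'
      obtain ⟨c, γ, rfl⟩ := hI'
      exact ⟨c, γ, by rwa [inf_comm] at hram⟩
  · rintro ⟨-, c, γ, hram⟩ _
    refine ⟨γ • G.cuspGp c, (CuspInertiaData.mem_inertiaSet_ofPSC_iff G _).2 ⟨c, γ, rfl⟩, ?_⟩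
    rwa [inf_comm]

/-- **SUB-NODE B4 of the Lem 4.5 SUB-DAG at `ofPSC G`, REDUCED** to layer L3's NAMED predicate
`PSCDatum.CuspidalEdgeLikeCharacterization G` (= [IUTchI] Rmk. 1.2.3 (iv), the corrected [CombGC]
Thm. 1.6 (i) characterisation of cuspidal edge-like subgroups) MODULO the encoding of "`≅ ℤ_l`":
the parents' intrinsic `AbsTopII.IsFreeProSigmaCyclic {l}` versus L3's "topologically generated by one
element and infinite" — supplied as the hypothesis `henc` (a statement about closed subgroups of the
pro-`l` group `H_*`, to be proved once in profinite group theory).  Needs a cusp (`X` not proper).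
[cite: Mochizuki2012, IUTchI Rmk 1.2.3(iv) pp.41-42] [cite: MochizukiAbsTopI2012, Lemma 4.5 (iv) p.54] -/
theorem CuspInertiaData.inertiaIffMaximalTotRam_ofPSC {l : ℕ}
    (hS : G.Sigma = {l}) (hC : Nonempty G.graph.C)
    (henc : ∀ A : Subgroup Hstar, IsClosed (A : Set Hstar) →
      (AbsTopII.IsFreeProSigmaCyclic {l} ↥A ↔
        (∃ a : Hstar, (Subgroup.zpowers a).topologicalClosure = A) ∧ (A : Set Hstar).Infinite))
    (h : G.CuspidalEdgeLikeCharacterization) :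
    (CuspInertiaData.ofPSC G).InertiaIffMaximalTotRam l := by
  have hL3 := h l hS
  set condL3 : Subgroup Hstar → Prop := fun A =>
    IsClosed (A : Set Hstar) ∧ (∃ a : Hstar, (Subgroup.zpowers a).topologicalClosure = A) ∧
      (A : Set Hstar).Infinite ∧
      ∀ U : Subgroup Hstar, U.Characteristic → IsOpen (U : Set Hstar) →
        G.IsCuspidallyTotallyRamified (A ⊔ U) U with hcondL3
  set condL4 : Subgroup Hstar → Prop := fun A =>
    IsClosed (A : Set Hstar) ∧ AbsTopII.IsFreeProSigmaCyclic {l} ↥A ∧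
      ∀ J : Subgroup Hstar, J.Characteristic → IsOpen (J : Set Hstar) → J ≠ A ⊔ J →
        (CuspInertiaData.ofPSC G).TotallyRamifiedAtSomeCusp (A ⊔ J) J with hcondL4
  have hcond : ∀ A : Subgroup Hstar, condL4 A ↔ condL3 A := by
    intro A
    constructor
    · rintro ⟨hc, hz, hJ⟩
      obtain ⟨hgen, hinf⟩ := (henc A hc).1 hz
      refine ⟨hc, hgen, hinf, fun U hU hUo => ?_⟩
      exact (CuspInertiaData.totallyRamifiedAtSomeCusp_ofPSC_iff G hC A U hU hUo).1 (hJ U hU hUo)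
    · rintro ⟨hc, hgen, hinf, hU⟩
      refine ⟨hc, (henc A hc).2 ⟨hgen, hinf⟩, fun J hJ hJo hne => ?_⟩
      exact (CuspInertiaData.totallyRamifiedAtSomeCusp_ofPSC_iff G hC A J hJ hJo).2 (hU J hJ hJo) hne
  intro I
  rw [CuspInertiaData.mem_inertiaSet_ofPSC_iff, hL3 I]
  change (condL3 I ∧ ∀ B, condL3 B → I ≤ B → I = B) ↔ (condL4 I ∧ ∀ I', I ≤ I' → condL4 I' → I = I')
  rw [hcond I]
  refine and_congr_right fun _ => forall_congr' fun B => ?_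
  rw [hcond B]
  exact ⟨fun hh hle hB => hh hB hle, fun hh hB hle => hh hle hB⟩

end Literature.AnabelianGeometry.AbsoluteAnabelian.FundamentalExtension

end
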